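import Literature.InformationTheory.Entropy.QuantumLeftoverHashCollision
import Literature.Computability.Cryptography.ToeplitzHashing
import HarnessLib

/-!
# Leftover hashing against quantum side information (Tomamichel–Schaffner–Smith–Renner 2011,
# Theorem 6 at ε = 0; Renner 2005, Corollary 5.5.2) — PROVED, guessing-probability form

Topic `InformationTheory/Entropy`, namespace `Literature.InformationTheory.Entropy`, sub-namespace
`QuantumLeftoverHash`. Third of three files (`QuantumLeftoverHashToolkit` → `…Collision` → this).
Everything here is PROVED from Mathlib + the tree (axioms `propext`, `Classical.choice`,
`Quot.sound`); no named fact, no `sorry`.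

## Source (read on the page; held text `paper:arxiv-1002.2436`, chunk p0009)

[cite: TomamichelEtAl2010, Theorem 6]: «Let `F` be two-universal and let `ρ_XE` and `ρ_ZEF` be
defined as in (11) and (12), respectively. Then, for any `ε ≥ 0`,
`d_u(Z|FE)_ρ ≤ ε + ½ √(2^{ℓ − H^ε_min(X|E)_ρ})`.» The proof first shows the case `ε = 0`,
eq. (17): `2 d_u(Z|FE)_ρ ≤ √(2^{ℓ − H_min(X|E)_ρ})`, by bounding (Lemma 4, first display)
`‖ρ_{ZFE} − ω_Z ⊗ ρ_{FE}‖₁ = E_f ‖ρ^{[f]}_{ZE} − ω_Z ⊗ ρ_E‖₁ = E_f Σ_z ‖ρ_E^{[f,z]} − 2^{−ℓ}ρ_E‖₁`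
(block-diagonal in `f` and `z`; `ρ_E^{[f,z]} := Σ_{x : f(x) = z} ρ_E^{[x]}`, eq. (13)); this
explicit quantity is (½ of) Renner's `d(ρ_{F(X)FE}|FE) := ‖ρ_{F(X)FE} − ρ_U ⊗ ρ_{FE}‖₁` of
[cite: Renner2005, Definition 5.2.1 and Corollary 5.5.2]
(`d ≤ √(tr ρ_XB) · 2^{−(H_min(ρ_XB|B) − ℓ)/2}`;
its smooth version with `+ 2ε` is Corollary 5.6.1; held text `paper:arxiv-quant-ph_0512258` chunks
p0052/p0055/p0056; «see also
[renner05]», TSSR11 before Theorem 6), and `d_u ≤` it by Definition 3 (minimum over `σ_{FE}`).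

## What is typed and proved

* `distFromUniform ρ K h := E_{k∈K} ½ Σ_z ‖ρ_E^{[h_k,z]} − |Z|⁻¹ ρ_E‖₁` (`‖·‖₁ = trNorm` = sum of
  absolute eigenvalues; `ρ_E^{[f,z]}` = the tree's `cqMap f ρ z`), for a cq state given by its
  conditional operators
  `ρ : X → Matrix e e ℂ` (the representation of `ConditionalMinEntropy.lean`) and a keyed family
  `h : κ → X → γ` with uniformly random key in `K : Finset κ`.
* `distFromUniform_le` (MAIN): for `ρ_E^{[x]} ⪰ 0`, `K ≠ ∅` and a TWO-UNIVERSAL family in the tree's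
  counting form `#{k ∈ K : h_k x = h_k x'} · |Z| ≤ |K|` (`x ≠ x'`):
  `distFromUniform ρ K h ≤ ½ √(|Z| · tr ρ_E · p_guess(X|E)_ρ)`.
* `distFromUniform_le_rpow_condMinEntropy` (PRINTED SHAPE, eq. (17)): for a sub-normalized cq
  state and `|Z| = 2^ℓ`, `distFromUniform ρ K h ≤ ½ √(2^{ℓ − H_min(X|E)_ρ})` with the tree's
  `condMinEntropy ρ = −log₂ guessProb ρ`.
* `distFromUniform_toeplitz_le` (APPLICATION): the bound for TOEPLITZ hashing over `𝔽₂`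
  (`LeftoverHash.toeplitz_universal`, the extractor family of the certified-randomness
  deployments [cite: LiuEtAl2025CertifiedRandomness, SM §III.F]): `≤ ½ √(2^{m − H_min(X|E)_ρ})`.

## Proof (= the printed one) and the two deviations

TSSR11's chain: Lemma 4 (Hölder) → Lemma 5 (two-universality, «the trace terms are positive»)
→ eq. (8) (collision ≤ min-entropy). Carried out here with `τ_E := ρ_E + η·1` (`η > 0`; the
print takes generalized inverses on the support — `distFromUniform_le_aux` is the fixed-`η`
bound `½ √(tr ρ_E + η dim E) √(|Z| p_guess)`, and `η ↓ 0` is `le_mul_sqrt_of_forall_pos`), and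
ENTRYWISE in an eigenbasis of `ρ_E` (file I). Deviation 1: ε = 0 only — the smooth statement
needs «purified distance ≥ trace distance» and the `σ`-minimum in `d_u`, not in the tree
(TODO(general form): `ε > 0`, and `δ`-almost universal families, [cite: TomamichelEtAl2010,
Theorem 7]). Deviation 2: the last step uses the pretty-good-measurement sub-POVM for
`τ = ρ_E + η` (file II, `sum_wform_le_guessProb`) instead of the optimised `σ_B` of Lemma 3; the
resulting bound is in terms of `p_guess(X|E)_ρ = 2^{−H_min(X|E)_ρ}` with `H_min` in the
guessing form, which IS the `H_min(X|E)_ρ` of eq. (17) for cq states by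
[cite: KoenigRennerSchaffner2008, Thm 1] (cited, not used). The constant `½` and the exponent
`(ℓ − H_min)/2` are the printed ones; the extra factor `tr ρ_E ≤ 1` is kept in the main form.

HONEST FRAMING. An extractor theorem (vocabulary/toolkit row CR-T4 of the certified-randomness
census): it says that two-universal hashing of `X` yields `E_k ½‖·‖₁`-close-to-uniform bits given
QUANTUM side information `E`, with the printed explicit constant. Nothing here models a protocol
transcript or an adversary class, and nothing here proves or refutes any quantum-advantage claim;
BQP vs BPP untouched.
-/

namespace Literature.InformationTheory.Entropy

open Matrix
open scoped ComplexOrder MatrixOrder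
open Literature.LinearAlgebra.Matrix.NearestPositiveSemidefinite (re_trace_mul_nonneg)

namespace QuantumLeftoverHash

variable {e : Type*} [Fintype e] [DecidableEq e]

/-! ### §7 The Leftover Hash Lemma against quantum side information

[cite: TomamichelEtAl2010, Theorem 6] (two-universal `F`, `ε = 0` case, eq. (17)):
`d_u(Z|FE)_ρ ≤ ½ √(2^{ℓ − H_min(X|E)_ρ})`, where the left side is bounded in the proof (Lemma 4,
first display) through `½‖ρ_{ZFE} − ω_Z ⊗ ρ_{FE}‖₁ = E_f ½‖ρ^{[f]}_{ZE} − ω_Z ⊗ ρ_E‖₁`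
`= E_f ½ Σ_z ‖ρ_E^{[f,z]} − 2^{−ℓ} ρ_E‖₁` (block-diagonal in `f` and `z`). We prove the bound for
this explicit distance `distFromUniform` (Renner's `d(ρ_{F(X)FE} | F E)`,
[cite: Renner2005, Corollary 5.5.2], halved); `d_u ≤ distFromUniform` by definition of the
minimum. -/

section Main

variable {X : Type*} [Fintype X] [DecidableEq X] {γ : Type*} [Fintype γ] [DecidableEq γ]
  {κ : Type*}

/-- **Distance from uniform after hashing** (strong-extractor form, key published):
`Δ(ρ, K, h) := E_{k ∈ K} ½ Σ_z ‖ρ_E^{[h_k,z]} − |Z|⁻¹·ρ_E‖₁ = ½‖ρ_{ZKE} − ω_Z ⊗ ρ_{KE}‖₁` for the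
uniformly keyed family `(h_k)_{k ∈ K}`. [cite: TomamichelEtAl2010, Definition 3 and eq. (12), (15)]
[cite: Renner2005, Definition 5.2.1 (the quantity `d(ρ_{F(X)FE}|FE)`, here with the factor ½)] -/
noncomputable def distFromUniform (ρ : X → Matrix e e ℂ) (K : Finset κ) (h : κ → X → γ) : ℝ :=
  (K.card : ℝ)⁻¹ * ∑ k ∈ K,
    (2⁻¹ * ∑ z, trNorm (cqMap (h k) ρ z - (Fintype.card γ : ℂ)⁻¹ • cqMarginal ρ))

omit [Fintype e] [DecidableEq e] [DecidableEq X] in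
/-- The deviation blocks `ρ_E^{[f,z]} − |Z|⁻¹ ρ_E` are Hermitian (so `‖·‖₁ = Σ|λ_i|` applies).
[cite: TomamichelEtAl2010, Lemma 4 (the operator `ρ_AB − ω_A ⊗ ρ_B`)] -/
theorem isHermitian_dev {ρ : X → Matrix e e ℂ} (hρ : ∀ x, (ρ x).PosSemidef) (f : X → γ) (z : γ) :
    (cqMap f ρ z - (Fintype.card γ : ℂ)⁻¹ • cqMarginal ρ).IsHermitian := by
  have h1 : (cqMap f ρ z).IsHermitian := (posSemidef_cqMap f hρ z).1
  have h2 : (cqMarginal ρ).IsHermitian := (posSemidef_sum _ fun x _ => hρ x).1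
  have hs : star ((Fintype.card γ : ℂ)⁻¹) = (Fintype.card γ : ℂ)⁻¹ := by
    rw [star_inv₀, star_natCast]
  change (cqMap f ρ z - (Fintype.card γ : ℂ)⁻¹ • cqMarginal ρ)ᴴ = _
  rw [conjTranspose_sub, conjTranspose_smul, hs, h1.eq, h2.eq]

omit [DecidableEq e] [DecidableEq X] [Fintype γ] in
/-- Rotating the deviation block into a basis `V`: `V*(ρ^{[f,z]} − c ρ_E)V = a^{[f,z]} − c a_E` for
`a_x := V* ρ_x V`.
[cite: TomamichelEtAl2010, Lemma 4 (proof; plumbing for the Hölder/Cauchy–Schwarz step)] -/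
theorem conj_dev (V : Matrix e e ℂ) (ρ : X → Matrix e e ℂ) (f : X → γ) (z : γ) (c : ℂ) :
    Vᴴ * (cqMap f ρ z - c • cqMarginal ρ) * V =
      cqMap f (fun x => Vᴴ * ρ x * V) z - c • cqMarginal (fun x => Vᴴ * ρ x * V) := by
  simp only [cqMap, cqMarginal, Matrix.mul_sub, Matrix.sub_mul, Finset.mul_sum, Finset.sum_mul,
    Matrix.mul_smul, Matrix.smul_mul]

/-- `0 ≤ B_w(T, T)` for positive weights (`Γ_C ≥ 0`). [cite: TomamichelEtAl2010, Definition 2] -/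
theorem wform_self_nonneg {w : e → ℝ} (hw : ∀ i, 0 < w i) (T : Matrix e e ℂ) : 0 ≤ wform w T T := by
  rw [wform_self_eq_sum]
  exact Finset.sum_nonneg fun i _ => Finset.sum_nonneg fun j _ =>
    div_nonneg (sq_nonneg _) (mul_pos (hw i) (hw j)).le

omit [Fintype e] [DecidableEq e] in
/-- Jensen / Cauchy–Schwarz for square roots: `Σ_i √q_i ≤ √(#s · Σ_i q_i)` («where we have used
Jensen's inequality»). [cite: Renner2005, Theorem 5.5.1 (proof)] -/
theorem sum_sqrt_le_sqrt_card_mul {ι : Type*} (s : Finset ι) (q : ι → ℝ) (hq : ∀ i ∈ s, 0 ≤ q i) :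
    ∑ i ∈ s, Real.sqrt (q i) ≤ Real.sqrt (s.card * ∑ i ∈ s, q i) := by
  have hcs := Finset.sum_mul_sq_le_sq_mul_sq s (fun _ => (1 : ℝ)) (fun i => Real.sqrt (q i))
  simp only [one_mul, one_pow, Finset.sum_const, nsmul_eq_mul, mul_one] at hcs
  have hsq : ∑ i ∈ s, Real.sqrt (q i) ^ 2 = ∑ i ∈ s, q i :=
    Finset.sum_congr rfl fun i hi => Real.sq_sqrt (hq i hi)
  rw [hsq] at hcs
  exact Real.le_sqrt_of_sq_le hcs

/-- `trNorm 0 = 0` (plumbing for the empty-source case).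
[cite: TomamichelEtAl2010, §2 (trace norm)] -/
theorem trNorm_zero : trNorm (0 : Matrix e e ℂ) = 0 := by
  obtain ⟨Λ, -, -, h⟩ := exists_signOp (isHermitian_zero : (0 : Matrix e e ℂ).IsHermitian)
  rw [← h, Matrix.mul_zero, trace_zero, Complex.zero_re]

/-- **Quantum Leftover Hash Lemma, fixed regularisation** `η > 0`:
`Δ ≤ ½ · √(tr ρ_E + η·dim E) · √(|Z| · p_guess(X|E)_ρ)`. (TSSR11's chain Lemma 4 → Lemma 5 →
eq. (8) with `τ_E = ρ_E + η·1`.) [cite: TomamichelEtAl2010, Theorem 6 (proof, case ε = 0)] -/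
theorem distFromUniform_le_aux [Nonempty γ] [Nonempty X] {ρ : X → Matrix e e ℂ}
    (hρ : ∀ x, (ρ x).PosSemidef) {K : Finset κ} (hK : K.Nonempty) {h : κ → X → γ}
    (hU : ∀ x x', x ≠ x' → (K.filter fun k => h k x = h k x').card * Fintype.card γ ≤ K.card)
    {η : ℝ} (hη : 0 < η) :
    distFromUniform ρ K h ≤ 2⁻¹ * Real.sqrt (cqTrace ρ + η * Fintype.card e) *
      Real.sqrt (Fintype.card γ * guessProb ρ) := by
  -- eigenbasis of the marginal `σ = ρ_E`
  set σ := cqMarginal ρ with hσdef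
  have hσ : σ.PosSemidef := posSemidef_sum _ fun x _ => hρ x
  have hσh : σ.IsHermitian := hσ.1
  have hsp := hσh.spectral_theorem
  rw [Unitary.conjStarAlgAut_apply] at hsp
  set V : Matrix e e ℂ := (hσh.eigenvectorUnitary : Matrix e e ℂ) with hVdef
  have hV : Vᴴ * V = 1 := by
    rw [← star_eq_conjTranspose]; exact Unitary.coe_star_mul_self hσh.eigenvectorUnitary
  have hV' : V * Vᴴ = 1 := by
    rw [← star_eq_conjTranspose]; exact Unitary.coe_mul_star_self hσh.eigenvectorUnitary
  set d : e → ℝ := fun i => hσh.eigenvalues i with hd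
  have hd0 : ∀ i, 0 ≤ d i := fun i => hσ.eigenvalues_nonneg i
  have hdiag : Vᴴ * σ * V = diagonal fun i => (d i : ℂ) := by
    have hD : diagonal (RCLike.ofReal ∘ hσh.eigenvalues) = diagonal fun i => ((d i : ℝ) : ℂ) := rfl
    rw [hsp, star_eq_conjTranspose, hD]
    calc Vᴴ * (V * (diagonal fun i => ((d i : ℝ) : ℂ)) * Vᴴ) * V
        = (Vᴴ * V) * (diagonal fun i => ((d i : ℝ) : ℂ)) * (Vᴴ * V) := by
          simp only [Matrix.mul_assoc]
      _ = diagonal fun i => ((d i : ℝ) : ℂ) := by rw [hV, Matrix.one_mul, Matrix.mul_one]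
  -- weights
  set w : e → ℝ := fun i => Real.sqrt (d i + η) with hw
  have hdη : ∀ i, 0 < d i + η := fun i => add_pos_of_nonneg_of_pos (hd0 i) hη
  have hwpos : ∀ i, 0 < w i := fun i => Real.sqrt_pos.2 (hdη i)
  have hsumw : ∑ i, w i ^ 2 = cqTrace ρ + η * Fintype.card e := by
    have h1 : ∑ i, w i ^ 2 = ∑ i, d i + ∑ _i : e, η := by
      rw [← Finset.sum_add_distrib]
      exact Finset.sum_congr rfl fun i _ => Real.sq_sqrt (hdη i).le
    have h2 : ∑ i, d i = cqTrace ρ := by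
      have ht := hσh.trace_eq_sum_eigenvalues
      have ht' : (σ.trace).re = ∑ i, d i := by
        rw [ht, Complex.re_sum]
        exact Finset.sum_congr rfl fun i _ => by simp [hd]
      rw [← ht', hσdef, cqMarginal, trace_sum, Complex.re_sum, cqTrace]
    rw [h1, h2, Finset.sum_const, Finset.card_univ, nsmul_eq_mul, mul_comm]
  -- rotated blocks
  set a : X → Matrix e e ℂ := fun x => Vᴴ * ρ x * V with ha
  have hapsd : ∀ x, (a x).PosSemidef := fun x => (hρ x).conjTranspose_mul_mul_same V
  set c : ℂ := (Fintype.card γ : ℂ)⁻¹ with hc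
  set q : κ → γ → ℝ := fun k z =>
    wform w (cqMap (h k) a z - c • cqMarginal a) (cqMap (h k) a z - c • cqMarginal a)
    with hq
  have hq0 : ∀ k z, 0 ≤ q k z := fun k z => wform_self_nonneg hwpos _
  -- blockwise: `‖S_{kz}‖₁ ≤ √(Σ w²) √(q k z)`
  have hblock : ∀ k z, trNorm (cqMap (h k) ρ z - c • σ) ≤
      Real.sqrt (∑ i, w i ^ 2) * Real.sqrt (q k z) := by
    intro k z
    obtain ⟨Λ, hΛ1, hΛ2, htr⟩ := exists_signOp (isHermitian_dev hρ (h k) z)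
    rw [← hc] at htr
    rw [← htr]
    have hcs := re_trace_mul_le_sqrt_wform hV hV' hΛ1 hΛ2 hwpos (S := cqMap (h k) ρ z - c • σ)
    rwa [hσdef, conj_dev] at hcs
  -- sum the block bounds
  have hKc : (0 : ℝ) < K.card := by exact_mod_cast hK.card_pos
  have hγc : (0 : ℝ) < Fintype.card γ := by exact_mod_cast Fintype.card_pos
  have hstep1 : distFromUniform ρ K h ≤
      2⁻¹ * Real.sqrt (∑ i, w i ^ 2) * ((K.card : ℝ)⁻¹ * ∑ k ∈ K, ∑ z, Real.sqrt (q k z)) := by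
    rw [distFromUniform, ← hc, ← hσdef]
    have hle : ∑ k ∈ K, (2⁻¹ * ∑ z, trNorm (cqMap (h k) ρ z - c • σ)) ≤
        ∑ k ∈ K, (2⁻¹ * ∑ z, Real.sqrt (∑ i, w i ^ 2) * Real.sqrt (q k z)) :=
      Finset.sum_le_sum fun k _ => mul_le_mul_of_nonneg_left
        (Finset.sum_le_sum fun z _ => hblock k z) (by norm_num)
    calc (K.card : ℝ)⁻¹ * ∑ k ∈ K, (2⁻¹ * ∑ z, trNorm (cqMap (h k) ρ z - c • σ))
        ≤ (K.card : ℝ)⁻¹ * ∑ k ∈ K, (2⁻¹ * ∑ z, Real.sqrt (∑ i, w i ^ 2) * Real.sqrt (q k z)) :=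
          mul_le_mul_of_nonneg_left hle (inv_nonneg.2 hKc.le)
      _ = 2⁻¹ * Real.sqrt (∑ i, w i ^ 2) * ((K.card : ℝ)⁻¹ * ∑ k ∈ K, ∑ z, Real.sqrt (q k z)) := by
          simp only [← Finset.mul_sum]
          ring
  -- Jensen: `E_k Σ_z √q ≤ √(|Z| · E_k Σ_z q)`
  have hstep2 : (K.card : ℝ)⁻¹ * ∑ k ∈ K, ∑ z, Real.sqrt (q k z) ≤
      Real.sqrt (Fintype.card γ * ((K.card : ℝ)⁻¹ * ∑ k ∈ K, ∑ z, q k z)) := by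
    have hj := sum_sqrt_le_sqrt_card_mul (K ×ˢ (Finset.univ : Finset γ)) (fun p => q p.1 p.2)
      (fun p _ => hq0 _ _)
    rw [Finset.sum_product, Finset.sum_product, Finset.card_product, Finset.card_univ,
      Nat.cast_mul] at hj
    have hKinv : (K.card : ℝ)⁻¹ = Real.sqrt ((K.card : ℝ)⁻¹ ^ 2) :=
      (Real.sqrt_sq (inv_nonneg.2 hKc.le)).symm
    calc (K.card : ℝ)⁻¹ * ∑ k ∈ K, ∑ z, Real.sqrt (q k z)
        ≤ (K.card : ℝ)⁻¹ * Real.sqrt (K.card * Fintype.card γ * ∑ k ∈ K, ∑ z, q k z) :=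
          mul_le_mul_of_nonneg_left hj (inv_nonneg.2 hKc.le)
      _ = Real.sqrt ((K.card : ℝ)⁻¹ ^ 2 * (K.card * Fintype.card γ * ∑ k ∈ K, ∑ z, q k z)) := by
          rw [Real.sqrt_mul (sq_nonneg _), ← hKinv]
      _ = Real.sqrt (Fintype.card γ * ((K.card : ℝ)⁻¹ * ∑ k ∈ K, ∑ z, q k z)) := by
          congr 1
          rw [sq, show (K.card : ℝ)⁻¹ * (K.card : ℝ)⁻¹ *
              ((K.card : ℝ) * (Fintype.card γ : ℝ) * ∑ k ∈ K, ∑ z, q k z) =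
            ((K.card : ℝ)⁻¹ * (K.card : ℝ)) *
              ((Fintype.card γ : ℝ) * ((K.card : ℝ)⁻¹ * ∑ k ∈ K, ∑ z, q k z)) by ring,
            inv_mul_cancel₀ hKc.ne', one_mul]
  -- collision bound and guessing bound
  have hstep3 : (K.card : ℝ)⁻¹ * ∑ k ∈ K, ∑ z, q k z ≤ guessProb ρ := by
    have h3 := avg_sum_wform_centered_le w hK h hU hapsd
    have h4 := sum_wform_le_guessProb hρ hV' hd0 hdiag hη
    exact h3.trans h4
  -- assemble
  have hsw0 : 0 ≤ Real.sqrt (∑ i, w i ^ 2) := Real.sqrt_nonneg _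
  calc distFromUniform ρ K h
      ≤ 2⁻¹ * Real.sqrt (∑ i, w i ^ 2) * ((K.card : ℝ)⁻¹ * ∑ k ∈ K, ∑ z, Real.sqrt (q k z)) :=
        hstep1
    _ ≤ 2⁻¹ * Real.sqrt (∑ i, w i ^ 2) *
          Real.sqrt (Fintype.card γ * ((K.card : ℝ)⁻¹ * ∑ k ∈ K, ∑ z, q k z)) :=
        mul_le_mul_of_nonneg_left hstep2 (by positivity)
    _ ≤ 2⁻¹ * Real.sqrt (∑ i, w i ^ 2) * Real.sqrt (Fintype.card γ * guessProb ρ) := by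
        refine mul_le_mul_of_nonneg_left (Real.sqrt_le_sqrt ?_) (by positivity)
        exact mul_le_mul_of_nonneg_left hstep3 hγc.le
    _ = 2⁻¹ * Real.sqrt (cqTrace ρ + η * Fintype.card e) *
          Real.sqrt (Fintype.card γ * guessProb ρ) := by rw [hsumw]

omit [Fintype e] [DecidableEq e] in
/-- Removing the regularisation: if `d ≤ m·√(t + η n)` for every `η > 0` then `d ≤ m·√t`
(`m, n, t ≥ 0`) — our replacement for the generalized inverse «taken on its support only».
[cite: TomamichelEtAl2010, §2 (generalized inverse); plumbing] -/
theorem le_mul_sqrt_of_forall_pos {d t m n : ℝ} (ht : 0 ≤ t) (hm : 0 ≤ m) (hn : 0 ≤ n)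
    (H : ∀ η : ℝ, 0 < η → d ≤ m * Real.sqrt (t + η * n)) : d ≤ m * Real.sqrt t := by
  refine le_of_not_gt fun hlt => ?_
  rcases hn.eq_or_lt with hn0 | hn0
  · have := H 1 one_pos
    rw [← hn0, mul_zero, add_zero] at this
    exact absurd this (not_le.2 hlt)
  rcases hm.eq_or_lt with hm0 | hm0
  · have := H 1 one_pos
    rw [← hm0, zero_mul] at this hlt
    exact absurd this (not_le.2 hlt)
  -- `m > 0`, `n > 0`: choose `η` with `t + η n < (d/m)²`
  have hdm : Real.sqrt t < d / m := by rwa [lt_div_iff₀ hm0, mul_comm]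
  have hdm0 : 0 < d / m := lt_of_le_of_lt (Real.sqrt_nonneg _) hdm
  have ht' : t < (d / m) ^ 2 := by
    have := Real.sqrt_lt_sqrt ht (show t < t + 1 from lt_add_one t)
    nlinarith [Real.sq_sqrt ht, Real.sqrt_nonneg t]
  set η : ℝ := ((d / m) ^ 2 - t) / (2 * n) with hηdef
  have hη : 0 < η := div_pos (sub_pos.2 ht') (by positivity)
  have hlt2 : t + η * n < (d / m) ^ 2 := by
    have : η * n = ((d / m) ^ 2 - t) / 2 := by
      rw [hηdef]; field_simp
    rw [this]; linarith
  have hs : Real.sqrt (t + η * n) < d / m := by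
    calc Real.sqrt (t + η * n) < Real.sqrt ((d / m) ^ 2) :=
          Real.sqrt_lt_sqrt (by positivity) hlt2
      _ = d / m := Real.sqrt_sq hdm0.le
  have := H η hη
  rw [lt_div_iff₀ hm0, mul_comm] at hs
  exact absurd this (not_le.2 hs)

/-- **Leftover Hash Lemma against quantum side information** (guessing-probability form;
[cite: TomamichelEtAl2010, Theorem 6 (ε = 0), eq. (17)]; [cite: Renner2005, Corollary 5.5.2]).
For a cq state `ρ_XE = Σ_x |x⟩⟨x| ⊗ ρ_E^{[x]}` (`ρ_E^{[x]} ⪰ 0`) and a family `(h_k)_{k ∈ K}`,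
`K ≠ ∅`, of hash functions `X → Z` that is TWO-UNIVERSAL (`#{k : h_k x = h_k x'} · |Z| ≤ |K|` for
`x ≠ x'`): `E_k ½ Σ_z ‖ρ_E^{[h_k,z]} − |Z|⁻¹ ρ_E‖₁ ≤ ½ √(|Z| · tr ρ_E · p_guess(X|E)_ρ)`.
Proof = TSSR11's (Lemma 4 Hölder step → Lemma 5 two-universality → collision ≤ guessing), carried
out entrywise in an eigenbasis of `ρ_E` with `τ_E = ρ_E + η·1`, `η ↓ 0`. -/
theorem distFromUniform_le [Nonempty γ] {ρ : X → Matrix e e ℂ} (hρ : ∀ x, (ρ x).PosSemidef)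
    {K : Finset κ} (hK : K.Nonempty) {h : κ → X → γ}
    (hU : ∀ x x', x ≠ x' → (K.filter fun k => h k x = h k x').card * Fintype.card γ ≤ K.card) :
    distFromUniform ρ K h ≤ 2⁻¹ * Real.sqrt (Fintype.card γ * cqTrace ρ * guessProb ρ) := by
  rcases isEmpty_or_nonempty X with hX | hX
  · -- no source symbols: every block vanishes
    have h0 : ∀ (f : X → γ) (z : γ),
        cqMap f ρ z - (Fintype.card γ : ℂ)⁻¹ • cqMarginal ρ = 0 := fun f z => by
      simp [cqMap, cqMarginal]
    have : distFromUniform ρ K h = 0 := by simp [distFromUniform, h0, trNorm_zero]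
    rw [this]
    positivity
  have htr : 0 ≤ cqTrace ρ :=
    Finset.sum_nonneg fun x _ => (RCLike.nonneg_iff.mp (hρ x).trace_nonneg).1
  have hmain : distFromUniform ρ K h ≤
      (2⁻¹ * Real.sqrt (Fintype.card γ * guessProb ρ)) * Real.sqrt (cqTrace ρ) := by
    refine le_mul_sqrt_of_forall_pos (n := Fintype.card e) htr (by positivity) (Nat.cast_nonneg _)
      fun η hη => ?_
    have := distFromUniform_le_aux hρ hK hU hη
    linarith [this]
  calc distFromUniform ρ K h
      ≤ (2⁻¹ * Real.sqrt (Fintype.card γ * guessProb ρ)) * Real.sqrt (cqTrace ρ) := hmain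
    _ = 2⁻¹ * Real.sqrt (Fintype.card γ * cqTrace ρ * guessProb ρ) := by
        rw [mul_assoc, ← Real.sqrt_mul (mul_nonneg (Nat.cast_nonneg _) (guessProb_nonneg hρ))]
        ring_nf

/-- **TSSR11 Theorem 6 (ε = 0) / Renner's Corollary 5.5.2 in the printed shape**: for a
sub-normalized cq state and `ℓ` output bits (`|Z| = 2^ℓ`),
`E_k ½ Σ_z ‖ρ_E^{[h_k,z]} − 2^{−ℓ} ρ_E‖₁ ≤ ½ · √(2^{ℓ − H_min(X|E)_ρ})`, with the tree's
`H_min(X|E)_ρ = −log₂ p_guess(X|E)_ρ` (`condMinEntropy`). [cite: TomamichelEtAl2010, Theorem 6,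
eq. (17)] [cite: Renner2005, Corollary 5.5.2] -/
theorem distFromUniform_le_rpow_condMinEntropy [Nonempty γ] {ρ : X → Matrix e e ℂ}
    (hρ : IsSubnormalizedCQ ρ) {K : Finset κ} (hK : K.Nonempty) {h : κ → X → γ}
    (hU : ∀ x x', x ≠ x' → (K.filter fun k => h k x = h k x').card * Fintype.card γ ≤ K.card)
    {ℓ : ℕ} (hγ : Fintype.card γ = 2 ^ ℓ) :
    distFromUniform ρ K h ≤ 2⁻¹ * Real.sqrt ((2 : ℝ) ^ ((ℓ : ℝ) - condMinEntropy ρ)) := by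
  have hmain := distFromUniform_le hρ.1 hK hU
  have hp0 : 0 ≤ guessProb ρ := guessProb_nonneg hρ.1
  have hc : (Fintype.card γ : ℝ) = (2 : ℝ) ^ ℓ := by rw [hγ]; push_cast; ring
  -- drop `tr ρ_E ≤ 1`
  have h1 : (Fintype.card γ : ℝ) * cqTrace ρ * guessProb ρ ≤ (2 : ℝ) ^ ℓ * guessProb ρ := by
    rw [hc]
    calc (2 : ℝ) ^ ℓ * cqTrace ρ * guessProb ρ = (2 : ℝ) ^ ℓ * guessProb ρ * cqTrace ρ := by ring
      _ ≤ (2 : ℝ) ^ ℓ * guessProb ρ * 1 :=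
          mul_le_mul_of_nonneg_left hρ.2 (mul_nonneg (pow_nonneg zero_le_two ℓ) hp0)
      _ = (2 : ℝ) ^ ℓ * guessProb ρ := mul_one _
  refine hmain.trans (mul_le_mul_of_nonneg_left (Real.sqrt_le_sqrt (h1.trans ?_)) (by norm_num))
  -- `2^ℓ · p = 2^{ℓ − H_min}` (or `≤` when `p = 0`)
  rcases hp0.eq_or_lt with hp | hp
  · rw [← hp, mul_zero]; positivity
  · rw [condMinEntropy, sub_neg_eq_add, Real.rpow_add two_pos, Real.rpow_natCast,
      Real.rpow_logb two_pos (by norm_num) hp]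

end Main

/-! ### §8 Application: Toeplitz hashing over `𝔽₂` (the deployed extractor family) -/

section Toeplitz

open Literature.Computability.Cryptography.LeftoverHash (toeplitz toeplitz_universal)

variable {n m : ℕ}

/-- **Quantum-proof Toeplitz hashing.** For a sub-normalized cq state on `X = 𝔽₂ⁿ` and the
Toeplitz family `y ↦ (x ↦ T_y x)` keyed by all `y ∈ 𝔽₂^{m+n−1}` (two-universal with collision
probability exactly `2^{−m}`, `LeftoverHash.toeplitz_universal`):
`E_y ½ Σ_z ‖ρ_E^{[T_y,z]} − 2^{−m} ρ_E‖₁ ≤ ½ √(2^{m − H_min(X|E)_ρ})`.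
[cite: TomamichelEtAl2010, Theorem 6 (ε = 0) with §4.2 (two-universal families)]
[cite: LiuEtAl2025CertifiedRandomness, SM §III.F (Toeplitz extractor, quantum-proof by [TSSR11])] -/
theorem distFromUniform_toeplitz_le [NeZero (m + n - 1)] {ρ : (Fin n → ZMod 2) → Matrix e e ℂ}
    (hρ : IsSubnormalizedCQ ρ) :
    distFromUniform ρ (Finset.univ : Finset (Fin (m + n - 1) → ZMod 2))
        (fun y x => (toeplitz (m := m) y).mulVec x) ≤
      2⁻¹ * Real.sqrt ((2 : ℝ) ^ ((m : ℝ) - condMinEntropy ρ)) := by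
  refine distFromUniform_le_rpow_condMinEntropy hρ Finset.univ_nonempty (fun x x' hx => ?_) ?_
  · exact (toeplitz_universal (m := m) hx).le.trans (by rw [Finset.card_univ])
  · rw [Fintype.card_fun, ZMod.card, Fintype.card_fin]

end Toeplitz

end QuantumLeftoverHash

end Literature.InformationTheory.Entropy
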